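import Literature.Probability.Percolation.CriticalContinuity
import HarnessLib

/-!
# Audit of p205010 — non-vacuity witnesses for the percolation probability `theta` of the summit conjunct

Adversarial audit `run/shared/lean/prim/audit-p205010/README.md`, checklist item (f): witnesses, proved
about the SAME objects the summit conjunct `PercolationContinuityZ3 := theta (zdGraph 3) 0 (criticalProbI 3) = 0`
unfolds to (`theta G x p = (bondPercolation G p).real (percolatesAt x)`, `bondPercolation G p = setBer(G.edgeSet, p)`
= Mathlib's `ProbabilityTheory.setBernoulli`, `zdGraph d = SimpleGraph.hasse (Fin d → ℤ)`), that `theta` is not a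
degenerate functional:

* `Audit.bondPercolation_zdGraph_real_univ` — the measure behind `theta` has total mass `1` (it is NOT the zero
  measure that a failed `Measure.comap` would silently produce);
* `Audit.theta_zdGraph_one` — **`θ_{ℤ^d}(1) = 1` for every `d ≥ 1`**: at `p = 1` the law is the Dirac mass at
  "every edge open" (`ProbabilityTheory.setBernoulli_one`) and the axis `ℤ e₀` lies in the open cluster of the
  origin, which is therefore infinite;
* `Audit.theta_zdGraph_dimZero` — `θ_{ℤ^0}(p) = 0` for every `p` (one site: no infinite cluster), so `theta` is
  not identically `1` either and genuinely depends on the graph;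
* `Audit.theta_zdGraph_three_one`, `Audit.exists_theta_zdGraph_three_ne_zero` — the same read at the summit's
  own graph `zdGraph 3` and base point `0 : Site 3`.

Companion witnesses already in the tree (all standard axioms): `criticalProb_zd_pos`, `criticalProb_zd_lt_one`,
`Grimmett1999_criticalProb_pos_lt_one_holds` (`0 < p_c(ℤ^d) < 1`, `d ≥ 2`, for THIS `criticalProb`/`theta`),
`theta_mono_holds`, `coe_criticalProbI : (criticalProbI d : ℝ) = criticalProb (zdGraph d) 0 := rfl`.
No new definitions; nothing here is used by the chain under audit.
-/

noncomputable section

namespace Summit.CriticalPhenomena.PercolationContinuityZ3.Theorems.Audit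

open MeasureTheory Literature.Probability.Percolation Literature.Probability.LatticeModels

/-- The bond percolation measure of `ℤ^d` behind `theta` is a probability measure: total mass `1`
(Mathlib's `setBernoulli` instance, through `instIsProbabilityMeasureBondPercolation`). [folklore] -/
theorem bondPercolation_zdGraph_real_univ (d : ℕ) (p : unitInterval) :
    (bondPercolation (zdGraph d) p).real Set.univ = 1 := by
  rw [measureReal_def, measure_univ, ENNReal.toReal_one]

/-- In particular the measure behind `theta` is not the zero measure. [folklore] -/
theorem bondPercolation_zdGraph_ne_zero (d : ℕ) (p : unitInterval) :
    bondPercolation (zdGraph d) p ≠ 0 :=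
  IsProbabilityMeasure.ne_zero _

/-- **`θ_{ℤ^d}(1) = 1` for `d ≥ 1`.** Under `P_1 = δ_{E(ℤ^d)}` every edge is open and the axis
`n ↦ n e₀` is an infinite open path from the origin. [folklore] -/
theorem theta_zdGraph_one {d : ℕ} (hd : 0 < d) : theta (zdGraph d) (0 : Site d) 1 = 1 := by
  have hmeas : bondPercolation (zdGraph d) 1 = Measure.dirac (zdGraph d).edgeSet := by
    rw [bondPercolation]; exact ProbabilityTheory.setBernoulli_one _
  rw [theta, hmeas, measureReal_def, Measure.dirac_apply_of_mem, ENNReal.toReal_one]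
  -- `E(ℤ^d) ∈ percolatesAt 0`: the open cluster of the origin contains the axis `ℤ e₀`
  set i : Fin d := ⟨0, hd⟩ with hi
  set f : ℕ → Site d := fun n => Pi.single i (n : ℤ) with hf
  have hadj : ∀ n, (openGraph ((zdGraph d).edgeSet)).Adj (f n) (f (n + 1)) := by
    intro n
    have hzd : (zdGraph d).Adj (f n) (f (n + 1)) := by
      rw [zdGraph_adj_iff]
      refine ⟨i, Or.inl ?_⟩
      simp only [hf]
      rw [← Pi.single_add]
      push_cast; rfl
    exact (openGraph_adj _ _ _).2 ⟨(SimpleGraph.mem_edgeSet _).2 hzd, hzd.ne⟩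
  have hreach : ∀ n, f n ∈ openCluster ((zdGraph d).edgeSet) (0 : Site d) := by
    intro n
    induction n with
    | zero =>
      have h0 : f 0 = 0 := by simp [hf]
      rw [h0]; exact mem_openCluster_self _ _
    | succ n ih => exact SimpleGraph.Reachable.trans ih (hadj n).reachable
  have hinj : Function.Injective f := by
    intro a b hab
    have := congrFun hab i
    simpa [hf] using this
  exact Set.infinite_of_injective_forall_mem hinj hreach

/-- **`θ_{ℤ^0}(p) = 0`**: `ℤ^0` is a single site, so no open cluster is infinite and the percolation
event is empty — `theta` genuinely depends on the graph. [folklore] -/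
theorem theta_zdGraph_dimZero (p : unitInterval) : theta (zdGraph 0) (0 : Site 0) p = 0 := by
  have h : percolatesAt (V := Site 0) 0 = ∅ := by
    ext ω
    simp only [percolatesAt, Set.mem_setOf_eq, Set.mem_empty_iff_false, iff_false, Set.not_infinite]
    exact Set.subsingleton_of_subsingleton.finite
  rw [theta, h, measureReal_empty]

/-- The summit's own objects: `θ_{ℤ³}(1) = 1` for `theta (zdGraph 3) (0 : Site 3)`, the functional whose
value at `criticalProbI 3` the conjunct `PercolationContinuityZ3` asserts to vanish. [folklore] -/
theorem theta_zdGraph_three_one : theta (zdGraph 3) (0 : Site 3) 1 = 1 :=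
  theta_zdGraph_one (by norm_num)

/-- Hence `p ↦ θ_{ℤ³}(p)` is not identically zero: the conjunct `θ_{ℤ³}(p_c) = 0` is a statement with
content (compare `criticalProb_zd_lt_one`: `p_c(ℤ³) < 1`). [folklore] -/
theorem exists_theta_zdGraph_three_ne_zero : ∃ p : unitInterval, theta (zdGraph 3) (0 : Site 3) p ≠ 0 :=
  ⟨1, by rw [theta_zdGraph_three_one]; exact one_ne_zero⟩

end Summit.CriticalPhenomena.PercolationContinuityZ3.Theorems.Audit

end
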